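import Literature.Computability.Complexity.MurrayWilliams2018Protocol
import Literature.Computability.Complexity.MurrayWilliams2018SimulationProofsQ
import HarnessLib

/-!
# Murray–Williams' headline `NQP ⊄ ACC⁰` from the language of Theorem 2.2 alone

Leaf module joining `MurrayWilliams2018Protocol.lean` — the headline
`MurrayWilliams2018_NQP_not_subset_ACC0 : ¬ (NQP ⊆ ACC0)` (`CircuitLowerBounds.lean`; C. D. Murray,
R. R. Williams, *Circuit lower bounds for nondeterministic quasi-polytime: an easy witness lemma for
NP and NQP*, STOC 2018, §1.1 and Thm. 1.3) from a `PSPACE`-hard, paddable, downward self-reducible,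
same-length checkable language without all-ones words (the data of Thm. 2.2) AND the
polylogarithmic-seed advice simulation `hsimQ`
(`MurrayWilliams2018_NQP_not_subset_ACC0_of_sameLengthChecker_of_qsimulation`) — with
`MurrayWilliams2018SimulationProofsQ.lean`, which PROVES `hsimQ` for every polynomial-time referee
(`MWSimQN.hsimQ_of_thm11`, over the tree's generator `IKW2002_thm11_tableGenerator`). Hence:

* **`MurrayWilliams2018_NQP_not_subset_ACC0_of_thm_2_2_language`** — `¬ (NQP ⊆ ACC0)` from the five
  clauses of Thm. 2.2 over the tree (`IsHard PSPACE Lstar`, paddability `1z ∈ Lstar ↔ z ∈ Lstar`,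
  no all-ones words, `AlmostAE.DSR Lstar`, `AlmostAE.SameLengthChecker Lstar`), nothing else;
* **`MurrayWilliams2018_NQP_not_subset_ACC0_of_exists_thm_2_2_language`** — the same over ONE
  existential hypothesis, the shape a discharge `MurrayWilliams2018_NQP_not_subset_ACC0_holds` will
  consume once the language of Thm. 2.2 (Santhanam, SIAM J. Comput. 39 (2009), over Trevisan–Vadhan,
  Comput. Complexity 16 (2007), §4: `L_PSPACE = {1ᵐ 0 x : x ∈ S_TV}`) is constructed in the tree.

So, as of this file, the trust base of the headline is exactly Thm. 2.2: Theorem 3.1 (both halves),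
Lemma 4.1 (polylogarithmic-seed form), Lemma 1.3, machine `B`, Williams' Fact 3.1 / Thm. 4.1 and
Murray–Williams' Thm. 5.1 are theorems of the tree. Theorems only; no definition and no named fact is
introduced (D-0026).

## References

* C. D. Murray, R. R. Williams, *Circuit lower bounds for nondeterministic quasi-polytime: an easy
  witness lemma for NP and NQP*, STOC 2018, 890–901 (ECCC TR17-188), §1.1, Thm. 2.2, Thm. 3.1,
  Lemma 4.1, §5, Thm. 1.3 [MurrayWilliams2018] (held: `paper:doi-10-1145-3188745-3188910`, pp. 3, 9–10).
* R. Santhanam, *Circuit lower bounds for Merlin–Arthur classes*, SIAM J. Comput. 39 (2009) 1038–1061.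
* L. Trevisan, S. Vadhan, *Pseudorandomness and average-case complexity via uniform reductions*,
  Comput. Complexity 16 (2007) 331–364, §4 [TrevisanVadhan2007].
-/

namespace Literature.Computability.Complexity

/-- **`NQP ⊄ ACC⁰` from the language of Theorem 2.2 alone**: Theorem 3.1 by
`MWProtocol.h31_of_sameLengthChecker`, Lemma 4.1 (polylogarithmic-seed form) with the simulation
`MWSimQN.hsimQ_of_thm11`, then `MurrayWilliams2018_NQP_not_subset_ACC0_of_lemma_4_1_qp` (machine `B`,
Fact 3.1, Thm. 4.1, Thm. 5.1 — all theorems); packaged by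
`MurrayWilliams2018_NQP_not_subset_ACC0_of_sameLengthChecker_of_qsimulation`.
[cite: MurrayWilliams2018, §1.1, Thm. 2.2, Thm. 3.1, Lemma 4.1 and Thm. 1.3] -/
theorem MurrayWilliams2018_NQP_not_subset_ACC0_of_thm_2_2_language (Lstar : Language Bool)
    (hhard : IsHard PSPACE Lstar) (hpad : ∀ z : List Bool, true :: z ∈ Lstar ↔ z ∈ Lstar)
    (hones : ∀ b : ℕ, List.replicate b true ∉ Lstar) (R : AlmostAE.DSR Lstar)
    (chk : AlmostAE.SameLengthChecker Lstar) : MurrayWilliams2018_NQP_not_subset_ACC0 :=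
  MurrayWilliams2018_NQP_not_subset_ACC0_of_sameLengthChecker_of_qsimulation Lstar hhard hpad hones R chk
    fun Ref hRef => MWSimQN.hsimQ_of_thm11 Ref hRef

/-- **`NQP ⊄ ACC⁰` from the existence of the language of Theorem 2.2** ("There is a
`PSPACE`-complete language `L_PSPACE` which is paddable, downward self-reducible, and furthermore is
checkable … `M` asks its oracle queries only of length `|x|`", rendered by the five clauses of
`MurrayWilliams2018_NQP_not_subset_ACC0_of_thm_2_2_language`; only `PSPACE`-hardness is used).
[cite: MurrayWilliams2018, Thm. 2.2 and §1.1] -/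
theorem MurrayWilliams2018_NQP_not_subset_ACC0_of_exists_thm_2_2_language
    (h22 : ∃ Lstar : Language Bool, IsHard PSPACE Lstar ∧
      (∀ z : List Bool, true :: z ∈ Lstar ↔ z ∈ Lstar) ∧ (∀ b : ℕ, List.replicate b true ∉ Lstar) ∧
      Nonempty (AlmostAE.DSR Lstar) ∧ Nonempty (AlmostAE.SameLengthChecker Lstar)) :
    MurrayWilliams2018_NQP_not_subset_ACC0 := by
  obtain ⟨Lstar, hhard, hpad, hones, ⟨R⟩, ⟨chk⟩⟩ := h22
  exact MurrayWilliams2018_NQP_not_subset_ACC0_of_thm_2_2_language Lstar hhard hpad hones R chk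

end Literature.Computability.Complexity
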